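import Summits.HodgeConjecture.HodgeConjecture.Theorems.Ring2HypothesesWeilComponentsSplit
import Summits.HodgeConjecture.HodgeConjecture.Theorems.Ring2AbelianAllTypeIIIFourfolds
import Summits.HodgeConjecture.HodgeConjecture.Theorems.Ring2AbelianAllWeilDiscriminantDescent
import Literature.AlgebraicGeometry.VanGeemen1994.HyperbolicOfSplitDiscriminant
import Literature.AlgebraicGeometry.VanGeemen1994.WeilDiscriminantOfProductTop
import Literature.AlgebraicGeometry.VanGeemen1994.WeilKFrame
import Literature.AlgebraicGeometry.Motives.SegreHyperplaneClassProdWeighted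
import Literature.AlgebraicGeometry.Motives.AimedSplitProductDischarge
import HarnessLib

/-!
# Ring 2 · AbelianAll (seat `ab-weil-2`, gen 3) — the SQUARE `A × A` of an even-dimensional Weil pair is ALWAYS SPLIT;
  squares of Weil-type surfaces carry a discriminant-1 structure (HC for all their powers modulo Floccari–Fu alone)

HONEST FRAMING (sub-cell `pub-hodge-ring2-ab-*`, verbatim): research route, not a corollary; conditional on HC_CM plus
one named minimal statement. (Cell `pub-hodge-ring2`, verbatim: research route conditional on HC_CM; not a corollary;
Q11.4-sentence-2 already refuted in dim ≥ 3.) `HC_CM` does not occur here. No definition, no named fact, no `sorry`; §2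
takes the refereed Floccari–Fu 2026 Thm. 1.2 / a split cell as BINDERS.

WHAT IS PROVED. §1 `isSplitWeilType_self_prod` — the third shape of the product-discriminant calculus of this seat
(`Ring2AbelianAllOddTimesCurve`: odd × curve; `Ring2AbelianAllOddTimesOdd`: odd × odd): for `(A, φ)` with
`dim A = m + 1` EVEN (`m` odd, `m ≥ 1`) and `φ ≫ φ = -d`, if `(A × A, φ × φ)` is of Weil type `(m + 1, m + 1)` then it is
of SPLIT Weil type — with NO re-weighting: the Segre polarization `L ⊠ L` with the SAME `K`-symmetrised class `h_K` on
both factors (`Motives.exists_segreEmbedding_self_prod`) has, by "det H is multiplicative"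
(`VanGeemen1994.hasWeilDiscriminantNondeg_prod_of_kFrames`) fed twice with ONE `K`-frame of `(A, φ, h_K)`
(`VanGeemen1994.exists_kFrame_ksymm`), the class `[(c₁ t)^{m+1} (c₂ t)^{m+1} q²]`, a SQUARE since `m + 1` is even, i.e.
`[1] = [(-1)^{m+1}]`; Landherr's converse (`VanGeemen1994.IsWeilType.isSplitWeilType_of_hasWeilDiscriminantNondeg_split`).
(For `dim A` odd, `(A × A, φ × φ)` is never of Weil type `(N, N)`: the multiplicities double.) §2: Weil classes of `A × A`
from the split cell alone; the square of a fourfold pair is a split eightfold (type `(4,4)`); the square `S × S` of a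
Weil-type SURFACE pair carries a `HasDiscOneWeilStructure`, hence HC for all powers of `S × S` modulo Floccari–Fu alone.

## References

* [vanGeemen1994HodgeAV] B. van Geemen, LNM 1594 (1994), Lemma 5.2 (2)–(4), 5.4 and (5.4.1).
* [Landherr1936HermitianForms] W. Landherr, Abh. Math. Sem. Hamburg 11 (1936) 245–248.
* [Hartshorne1977] R. Hartshorne, Algebraic Geometry, II Ex. 5.11–5.12.
* [FloccariFu2026] S. Floccari, L. Fu, J. Math. Pures Appl. 210 (2026) 103876, Thm. 1.2.
* [Markman2025SurveySecant] E. Markman, arXiv:2509.23403, §11.5 (product polarizations and discriminants).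
-/

set_option linter.dupNamespace false

noncomputable section

open CategoryTheory

namespace Summit.HodgeConjecture.HodgeConjecture.Ring2.AbelianAll

open Literature.AlgebraicGeometry Literature.AlgebraicGeometry.Motives
open Literature.AlgebraicGeometry.HodgeTheory Literature.AlgebraicGeometry.VanGeemen1994
open Literature.AlgebraicTopology.SingularHomology
open Literature.Geometry.Kaehler
open Summit.HodgeConjecture.HodgeConjecture.WeilTypeLadder
open Summit.HodgeConjecture.HodgeConjecture.Theses
open Summit.HodgeConjecture.HodgeConjecture.Ring2.Hypotheses

/-! ## §1 The square of an even-dimensional Weil pair is split -/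

/-- **`A × A` is of SPLIT Weil type whenever `(A × A, φ × φ)` is of Weil type `(m + 1, m + 1)`, `dim A = m + 1` EVEN**
(`m` odd, `m ≥ 1`; `φ ≫ φ = -(d • 𝟙 A)`, `d ≥ 1`). The hyperbolic class is the `K`-symmetrisation of the plain Segre
polarization `L ⊠ L`: one `K`-frame of `(A, φ, h_K)` on both factors gives the product class
`[(c₁ t)^{m+1} (c₂ t)^{m+1} q²] = [1] = [(-1)^{m+1}]`, then Landherr's converse. No named fact, no re-weighting.
[cite: vanGeemen1994HodgeAV, Lemma 5.2 (2)–(4), 5.4 and (5.4.1)] [cite: Landherr1936HermitianForms]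
[cite: Hartshorne1977, II Ex. 5.11 and Ex. 5.12] -/
theorem isSplitWeilType_self_prod {A : AbelianVariety ℂ} {m : ℕ} (hA : A.dim = m + 1) (hm : 1 ≤ m) (hmo : Odd m)
    {d : ℕ} (hd : 0 < d) {φ : A ⟶ A} (hφ : φ ≫ φ = -(d • 𝟙 A))
    (hW : IsWeilType (A.prod A)
      (AbelianVariety.prodLift (AbelianVariety.fst A A ≫ φ) (AbelianVariety.snd A A ≫ φ)) (m + 1) d) :
    IsSplitWeilType (A.prod A)
      (AbelianVariety.prodLift (AbelianVariety.fst A A ≫ φ) (AbelianVariety.snd A A ≫ φ)) (m + 1) d := by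
  classical
  set Φ := AbelianVariety.prodLift (AbelianVariety.fst A A ≫ φ) (AbelianVariety.snd A A ≫ φ) with hΦ
  -- (1) the Segre embedding of `A × A` with equal classes, and ONE `K`-frame of `(A, φ, h_K)`
  obtain ⟨eA, aA, e, a, haA, haA0, ha, ha0, he⟩ := exists_segreEmbedding_self_prod A
  obtain ⟨x, ω, am, bm, q, t, hx, hi, hω, hω0, hp, hq, ht⟩ := exists_kFrame_ksymm hm hA hd hφ eA haA haA0
  set hK := (d : ℂ) • complexBetti.map eA.ι 2 aA + complexBetti.map φ.hom.hom.hom 2 (complexBetti.map eA.ι 2 aA)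
    with hKdef
  have hh : (d : ℂ) • complexBetti.map e.ι 2 a + complexBetti.map Φ.hom.hom.hom 2 (complexBetti.map e.ι 2 a) =
      complexBetti.map (AbelianVariety.fst A A).hom.hom.hom 2 hK +
        complexBetti.map (AbelianVariety.snd A A).hom.hom.hom 2 hK := by
    rw [he, map_add, map_prodLift_map_fst φ φ 2, map_prodLift_map_snd φ φ 2, hKdef]
    simp only [map_add, map_smul, smul_add]
    abel
  -- (2) "det H is multiplicative", fed twice with the same frame
  have hN : 2 * (m + 1) = m + m + 2 := by omega
  let ε : Fin (m + 1) ⊕ Fin (m + 1) ≃ Fin (2 * (m + 1)) := finSumFinEquiv.trans (finCongr (by omega))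
  obtain ⟨ht0, -⟩ := prod_kFrames_top_ne_zero hA hA hN (kA := m + 1) (kB := m + 1) (by omega) (by omega) (by omega)
    hd hφ hφ x hx hi hK ω am bm hp t ht x hx hi hK ω am bm hp t ht e ha ha0 hh
  have hδ := hasWeilDiscriminantNondeg_prod_of_kFrames hA hA hN ε x hx hi hK ω hω hω0 am bm hp t ht ht0 q hq
    x hx hi hK ω hω hω0 am bm hp t ht ht0 q hq
  rw [← hh] at hδ
  -- (3) the class is a square: `m + 1 = 2(k + 1)`
  obtain ⟨k, hk⟩ := hmo
  have h2 : m + 1 = 2 * (k + 1) := by omega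
  set c₁ : ℚ := ((2 * (m + 1) - 1).choose m : ℚ) with hc₁
  set c₂ : ℚ := ((2 * (m + 1) - 1).choose (m + 1) : ℚ) with hc₂
  have hc₁0 : c₁ ≠ 0 := by
    rw [hc₁]
    exact_mod_cast (Nat.choose_pos (by omega)).ne'
  have hc₂0 : c₂ ≠ 0 := by
    rw [hc₂]
    exact_mod_cast (Nat.choose_pos (by omega)).ne'
  have hv0 : (c₁ * t) ^ (k + 1) * (c₂ * t) ^ (k + 1) * (q : ℚ) ≠ 0 :=
    mul_ne_zero (mul_ne_zero (pow_ne_zero _ (mul_ne_zero hc₁0 ht0)) (pow_ne_zero _ (mul_ne_zero hc₂0 ht0)))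
      q.ne_zero
  have hsq : Units.mk0 _ hv0 ^ 2 ∈ normUnitsSubgroup ℚ (weilField d) := by
    have h := pow_finrank_mem_normUnitsSubgroup (F := ℚ) (K := weilField d) (Units.mk0 _ hv0)
    rwa [finrank_weilField] at h
  have hunit : ((-1 : ℚˣ) ^ (m + 1)) = 1 := by rw [h2, pow_mul, neg_one_sq, one_pow]
  have hclass : ∀ pf : (c₁ * t) ^ (m + 1) * (c₂ * t) ^ (m + 1) ≠ 0,
      (QuotientGroup.mk (Units.mk0 ((c₁ * t) ^ (m + 1) * (c₂ * t) ^ (m + 1)) pf * q * q) : weilNormResidueGroup d) =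
        QuotientGroup.mk ((-1 : ℚˣ) ^ (m + 1)) := by
    intro pf
    have hwsq : Units.mk0 ((c₁ * t) ^ (m + 1) * (c₂ * t) ^ (m + 1)) pf * q * q = Units.mk0 _ hv0 ^ 2 :=
      Units.ext (by
        rw [Units.val_mul, Units.val_mul, Units.val_mk0, Units.val_pow_eq_pow_val, Units.val_mk0, h2, pow_mul, pow_mul]
        ring)
    rw [hwsq, hunit, QuotientGroup.mk_one]
    exact (QuotientGroup.eq_one_iff _).2 hsq
  rw [hclass] at hδ
  -- (4) Landherr's converse on the carriers
  exact VanGeemen1994.IsWeilType.isSplitWeilType_of_hasWeilDiscriminantNondeg_split hW e ha ha0 hδ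

/-! ## §2 Consequences -/

/-- **The Weil classes of `A × A` (`dim A` even, `≥ 2`) are algebraic granted the split cell `(m + 1, d, [1])` ALONE**
(binder `h`). [cite: vanGeemen1994HodgeAV, Lemma 5.2 and (5.4.1)] -/
theorem weilClasses_algebraic_self_prod_of_split_component {A : AbelianVariety ℂ} {m : ℕ} (hA : A.dim = m + 1)
    (hm : 1 ≤ m) (hmo : Odd m) {d : ℕ} (hd : 0 < d)
    (h : WeilClassesComponent (m + 1) d (splitDiscriminantClass (m + 1) d)) {φ : A ⟶ A} (hφ : φ ≫ φ = -(d • 𝟙 A))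
    (hW : IsWeilType (A.prod A)
      (AbelianVariety.prodLift (AbelianVariety.fst A A ≫ φ) (AbelianVariety.snd A A ≫ φ)) (m + 1) d)
    {c : complexBetti (A.prod A).X (2 * (m + 1))} (hcQ : IsRationalClass c)
    (hcH : IsOfHodgeType (2 * (m + 1)) (A.prod A).X (2 * (m + 1)) (m + 1) (m + 1) c)
    (hw : c ∈ weilClassesOf (A.prod A)
      (AbelianVariety.prodLift (AbelianVariety.fst A A ≫ φ) (AbelianVariety.snd A A ≫ φ)) (m + 1) d) :
    c ∈ algebraicClasses (A.prod A).X (m + 1) :=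
  weilClasses_algebraic_of_isSplitWeilType_of_split_component h (isSplitWeilType_self_prod hA hm hmo hd hφ hW)
    hcQ hcH hw

/-- **The square of a Weil fourfold pair is a SPLIT eightfold** (type `(4,4)`): e.g. `X × X` for a NON-split Weil-type
fourfold `X` (atlas cell `HodgePowersOfWeilTypeFourfold`, second power). No named fact.
[cite: vanGeemen1994HodgeAV, Lemma 5.2 and (5.4.1)] [cite: Landherr1936HermitianForms] -/
theorem isSplitWeilType_fourfold_sq {A : AbelianVariety ℂ} (hA : A.dim = 4) {d : ℕ} (hd : 0 < d) {φ : A ⟶ A}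
    (hφ : φ ≫ φ = -(d • 𝟙 A))
    (hW : IsWeilType (A.prod A)
      (AbelianVariety.prodLift (AbelianVariety.fst A A ≫ φ) (AbelianVariety.snd A A ≫ φ)) 4 d) :
    IsSplitWeilType (A.prod A)
      (AbelianVariety.prodLift (AbelianVariety.fst A A ≫ φ) (AbelianVariety.snd A A ≫ φ)) 4 d :=
  isSplitWeilType_self_prod (m := 3) hA (by norm_num) ⟨1, rfl⟩ hd hφ hW

/-- **The square `S × S` of a Weil-type SURFACE pair carries a discriminant-1 Weil structure** (`HasDiscOneWeilStructure`,
the Floccari–Fu input): `dim S = 2`, `φ ≫ φ = -d`, `(S × S, φ × φ)` of Weil type `(2, 2)`. No named fact.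
[cite: vanGeemen1994HodgeAV, Lemma 5.2 and (5.4.1)] [cite: FloccariFu2026, p. 3] -/
theorem hasDiscOneWeilStructure_surface_sq {S : AbelianVariety ℂ} (hS : S.dim = 2) {d : ℕ} (hd : 0 < d) {φ : S ⟶ S}
    (hφ : φ ≫ φ = -(d • 𝟙 S))
    (hW : IsWeilType (S.prod S)
      (AbelianVariety.prodLift (AbelianVariety.fst S S ≫ φ) (AbelianVariety.snd S S ≫ φ)) 2 d) :
    HasDiscOneWeilStructure (S.prod S) := by
  obtain ⟨-, -, -, hΦ2, e, a, ha, ha0, hh⟩ :=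
    isSplitWeilType_iff.1 (isSplitWeilType_self_prod (m := 1) hS le_rfl ⟨0, rfl⟩ hd hφ hW)
  exact ⟨_, d, e, a, hd, hΦ2, ha, ha0, hh⟩

/-- **HC for ALL POWERS of `S × S`, `S` a Weil-type surface pair, modulo Floccari–Fu 2026 Thm. 1.2 ALONE** (binder `h5`).
[cite: FloccariFu2026, Theorem 1.2] -/
theorem hodgeConjectureFor_powSucc_surface_sq_of_floccariFu
    (h5 : FloccariFu2026_hodgeClasses_algebraic_powers_discOneWeilFourfold)
    {S : AbelianVariety ℂ} (hS : S.dim = 2) {d : ℕ} (hd : 0 < d) {φ : S ⟶ S} (hφ : φ ≫ φ = -(d • 𝟙 S))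
    (hW : IsWeilType (S.prod S)
      (AbelianVariety.prodLift (AbelianVariety.fst S S ≫ φ) (AbelianVariety.snd S S ≫ φ)) 2 d) (N : ℕ) :
    HodgeConjectureFor ((S.prod S).powSucc N).dim ((S.prod S).powSucc N).X :=
  hodgeConjectureFor_powSucc_of_floccariFu_of_hasDiscOneWeilStructure h5 (S.prod S)
    (by rw [AbelianVariety.dim_prod, hS]) (hasDiscOneWeilStructure_surface_sq hS hd hφ hW) N

end Summit.HodgeConjecture.HodgeConjecture.Ring2.AbelianAll

end
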